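import Literature.Analysis.FluidPDE.ParticleTrajectoryFlow
import Literature.Analysis.FluidPDE.MovingDomainTransportFormula
import Literature.Analysis.FluidPDE.IncompressibleFlow
import HarnessLib

/-!
# Majda–Bertozzi §1.3 along the particle trajectories of a velocity field on a time set:
# (1.15), `J > 0`, Prop. 1.4 (i) ⟺ (ii) ⟺ (iii) and the transport formula (1.16), within `S`

Literature file (topic `Analysis/FluidPDE`): A. J. Majda, A. L. Bertozzi, *Vorticity and
Incompressible Flow* (CUP 2002), §1.3, held text pp. 13–15 ((1.13)–(1.16), Def. 1.1,
Props. 1.2–1.4). Companion of `ParticleTrajectoryMapJacobian.lean`, which proves the same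
statements for the map `particleTrajectoryMap hC` of a velocity field smooth on all of `ℝ × E`
with a GLOBAL space–time Lipschitz bound. Here the velocity field `u : ℝ → E → E` (`E` a
finite-dimensional real inner product space with its volume measure — MB: `ℝᴺ`) is only jointly
smooth on a convex time set `S ∋ 0` of unique differentiability (`IsSmoothSpaceTimeOn S u`) and
satisfies the Cauchy–Lipschitz hypotheses there (`ODE.IsUniformlyLipschitzOn u S`: e.g. bounded
gradient on compact sub-slabs, `IsSmoothSpaceTimeOn.isUniformlyLipschitzOn_of_norm_fderiv_le`),
and the particle-trajectory map is `X(·, t) = ODE.evolutionMap u 0 t` (`ParticleTrajectoryFlow.lean`: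
(1.13) within `S`, bijective slices, jointly smooth on `S × E`). Every statement is the tree's
flow-hypothesis theorem (`ParticleTrajectoryJacobian.lean`, `MovingDomainTransportFormula.lean`,
`IncompressibleFlow.lean`) with the trajectory hypotheses discharged; all within `S`
(one-sided time derivatives at the ends of `S`). Theorems only; no definitions, no named facts.

* `hasDerivWithinAt_jacobian_evolutionMap` — **(1.15)** `∂ₜJ = (div u)(X, t) J` within `S`;
  `det_fderiv_evolutionMap_pos` — `J > 0` on `S × E`;
* `det_fderiv_evolutionMap_eq_one`, `isDivFree_of_det_fderiv_evolutionMap_eq_one`,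
  `isDivFree_iff_det_fderiv_evolutionMap_eq_one` — **Prop. 1.4 (ii) ⟺ (iii)**;
* `setIntegral_image_evolutionMap_eq` — the change of variables `α ↦ X(α, t)`;
  `hasDerivWithinAt_setIntegral_image_evolutionMap` — **Prop. 1.3 (1.16)** for bounded
  measurable `Ω` and `f` jointly smooth on `S × E`; `…_of_isDivFree`;
  `hasDerivWithinAt_volume_image_evolutionMap` — (1.16) with `f ≡ 1`;
* `isIncompressibleFlowOn_evolutionMap_iff_det_fderiv_eq_one`,
  `isIncompressibleFlowOn_evolutionMap_iff_isDivFree` — **Def. 1.1 / Prop. 1.4 (i) ⟺ (iii) ⟺ (ii)**: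
  the flow is volume preserving on `S` iff `J ≡ 1` iff `div u = 0` on `S`.

HONEST FRAMING (cell `pub-fluidc`): typed textbook infrastructure for a low prior, high
value-of-information experiment on Tao's machine paradigm; NOT a claim that NS blows up.

## References

* [MajdaBertozziCUP2002] A. J. Majda, A. L. Bertozzi, Vorticity and Incompressible Flow, CUP 2002
  — §1.3 (1.13)–(1.16), Def. 1.1, Props. 1.2, 1.3, 1.4 (held text pp. 13–15).
-/

noncomputable section

open Set Function Filter Topology MeasureTheory Metric
open scoped NNReal ContDiff

namespace Literature.Analysis.FluidPDE

section FinDim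

variable {E : Type*} [NormedAddCommGroup E] [InnerProductSpace ℝ E] [FiniteDimensional ℝ E]
  [CompleteSpace E]
variable {S : Set ℝ} {u : ℝ → E → E} {f : ℝ → E → ℝ}

omit [FiniteDimensional ℝ E] in
/-- (1.13) within `S`, in the `∀ t ∈ S, ∀ y` form of the tree's Lagrangian files.
[cite: MajdaBertozziCUP2002, §1.3 (1.13)] -/
private theorem trajS (hL : ODE.IsUniformlyLipschitzOn u S) (hS : Convex ℝ S) (h0 : (0 : ℝ) ∈ S) :
    ∀ t ∈ S, ∀ y, HasDerivWithinAt (fun s => ODE.evolutionMap u 0 s y)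
      (u t (ODE.evolutionMap u 0 t y)) S t :=
  fun _ ht y => hL.hasDerivWithinAt_evolutionMap hS h0 ht y

/-! ### (1.15) and `J > 0` -/

/-- **Majda–Bertozzi Prop. 1.2, eq. (1.15), along the trajectories within `S`**: for `u` jointly
smooth on the convex time set `S ∋ 0` (of unique differentiability) with the Cauchy–Lipschitz
hypotheses, and `X(·,t) = φ(t, 0, ·)`, `J(α,t) = det ∇_αX(α,t)` satisfies
`∂ₜJ = (div u)(X(α,t),t) J` within `S` at every `t ∈ S`.
[cite: MajdaBertozziCUP2002, §1.3 Prop. 1.2 eq. (1.15) (held text p. 14)] -/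
theorem hasDerivWithinAt_jacobian_evolutionMap (hL : ODE.IsUniformlyLipschitzOn u S)
    (hu : IsSmoothSpaceTimeOn S u) (hS : Convex ℝ S) (h0 : (0 : ℝ) ∈ S) (hU : UniqueDiffOn ℝ S)
    {t : ℝ} (ht : t ∈ S) (a : E) :
    HasDerivWithinAt (fun r => (fderiv ℝ (ODE.evolutionMap u 0 r) a).det)
      (VectorCalculus.divergence (u t) (ODE.evolutionMap u 0 t a)
        * (fderiv ℝ (ODE.evolutionMap u 0 t) a).det) S t :=
  hasDerivWithinAt_jacobian hu (isSmoothSpaceTimeOn_evolutionMap hL hu hS hU h0) hU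
    (trajS hL hS h0) ht a

/-- **`J > 0`** along the trajectories within `S`: `det ∇_αX(α,t) > 0` for `t ∈ S`, `α ∈ E`.
[cite: MajdaBertozziCUP2002, §1.3 Prop. 1.2 eq. (1.15) (held text p. 14)] -/
theorem det_fderiv_evolutionMap_pos (hL : ODE.IsUniformlyLipschitzOn u S)
    (hu : IsSmoothSpaceTimeOn S u) (hS : Convex ℝ S) (h0 : (0 : ℝ) ∈ S) (hU : UniqueDiffOn ℝ S)
    {t : ℝ} (ht : t ∈ S) (a : E) : 0 < (fderiv ℝ (ODE.evolutionMap u 0 t) a).det :=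
  det_fderiv_flow_pos hS h0 hu (isSmoothSpaceTimeOn_evolutionMap hL hu hS hU h0) (trajS hL hS h0)
    (ODE.evolutionMap_self u 0) ht a

/-! ### Prop. 1.4 (ii) ⟺ (iii) -/

/-- **Prop. 1.4 (ii) ⇒ (iii)** along the trajectories within `S`: if `div u(t,·) = 0` for
`t ∈ S`, then `J(α,t) = 1` on `S × E`.
[cite: MajdaBertozziCUP2002, §1.3 Prop. 1.4 (ii) ⇒ (iii) (held text p. 14)] -/
theorem det_fderiv_evolutionMap_eq_one (hL : ODE.IsUniformlyLipschitzOn u S)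
    (hu : IsSmoothSpaceTimeOn S u) (hS : Convex ℝ S) (h0 : (0 : ℝ) ∈ S) (hU : UniqueDiffOn ℝ S)
    (hdiv : ∀ t ∈ S, VectorCalculus.IsDivFree (u t)) {t : ℝ} (ht : t ∈ S) (a : E) :
    (fderiv ℝ (ODE.evolutionMap u 0 t) a).det = 1 :=
  det_fderiv_flow_eq_one hS h0 hu (isSmoothSpaceTimeOn_evolutionMap hL hu hS hU h0)
    (trajS hL hS h0) (ODE.evolutionMap_self u 0) hdiv ht a

/-- **Prop. 1.4 (iii) ⇒ (ii)** along the trajectories within `S` (every `X(·,t)` is onto): if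
`J ≡ 1` on `S × E`, then `div u(t,·) = 0` for `t ∈ S`.
[cite: MajdaBertozziCUP2002, §1.3 Prop. 1.4 (iii) ⇒ (ii) (held text p. 14)] -/
theorem isDivFree_of_det_fderiv_evolutionMap_eq_one (hL : ODE.IsUniformlyLipschitzOn u S)
    (hu : IsSmoothSpaceTimeOn S u) (hS : Convex ℝ S) (h0 : (0 : ℝ) ∈ S) (hU : UniqueDiffOn ℝ S)
    (hJ : ∀ t ∈ S, ∀ a, (fderiv ℝ (ODE.evolutionMap u 0 t) a).det = 1) {t : ℝ} (ht : t ∈ S) :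
    VectorCalculus.IsDivFree (u t) :=
  isDivFree_of_det_fderiv_flow_eq_one hu (isSmoothSpaceTimeOn_evolutionMap hL hu hS hU h0) hU
    (trajS hL hS h0) (fun _ hs => (bijective_evolutionMap_zero hL hS h0 hs).surjective) hJ ht

/-- **Prop. 1.4 (ii) ⟺ (iii)** along the trajectories within `S`: `div u = 0` on `S` iff
`J ≡ 1` on `S × E`. [cite: MajdaBertozziCUP2002, §1.3 Prop. 1.4 (held text p. 14)] -/
theorem isDivFree_iff_det_fderiv_evolutionMap_eq_one (hL : ODE.IsUniformlyLipschitzOn u S)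
    (hu : IsSmoothSpaceTimeOn S u) (hS : Convex ℝ S) (h0 : (0 : ℝ) ∈ S) (hU : UniqueDiffOn ℝ S) :
    (∀ t ∈ S, VectorCalculus.IsDivFree (u t)) ↔
      ∀ t ∈ S, ∀ a, (fderiv ℝ (ODE.evolutionMap u 0 t) a).det = 1 :=
  isDivFree_iff_det_fderiv_flow_eq_one hS h0 hU hu (isSmoothSpaceTimeOn_evolutionMap hL hu hS hU h0)
    (trajS hL hS h0) (ODE.evolutionMap_self u 0)
    fun _ hs => (bijective_evolutionMap_zero hL hS h0 hs).surjective

/-! ### The change of variables and Prop. 1.3 (1.16) -/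

section Measure

variable [MeasurableSpace E] [BorelSpace E]

/-- **Change of variables along the trajectories**: for measurable `Ω` and `t ∈ S`,
`∫_{X(Ω,t)} g dx = ∫_Ω g(X(α,t)) J(α,t) dα`.
[cite: MajdaBertozziCUP2002, §1.3 proof of Prop. 1.3, first display (held text p. 14)] -/
theorem setIntegral_image_evolutionMap_eq (hL : ODE.IsUniformlyLipschitzOn u S)
    (hu : IsSmoothSpaceTimeOn S u) (hS : Convex ℝ S) (h0 : (0 : ℝ) ∈ S) (hU : UniqueDiffOn ℝ S)
    {t : ℝ} (ht : t ∈ S) {Ω : Set E} (hΩm : MeasurableSet Ω) (g : E → ℝ) :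
    ∫ x in ODE.evolutionMap u 0 t '' Ω, g x =
      ∫ a in Ω, g (ODE.evolutionMap u 0 t a) * (fderiv ℝ (ODE.evolutionMap u 0 t) a).det :=
  setIntegral_image_flow_eq hS h0 hu (isSmoothSpaceTimeOn_evolutionMap hL hu hS hU h0)
    (trajS hL hS h0) (ODE.evolutionMap_self u 0) ht hΩm
    (bijective_evolutionMap_zero hL hS h0 ht).injective.injOn g

/-- **Majda–Bertozzi Prop. 1.3, the transport formula (1.16), along the trajectories within
`S`**: for `u` jointly smooth on the convex time set `S ∋ 0` (of unique differentiability) with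
the Cauchy–Lipschitz hypotheses, `X(·,t) = φ(t, 0, ·)`, `f` jointly smooth on `S × E` and `Ω`
bounded measurable, `d/dt ∫_{X(Ω,t)} f dx = ∫_{X(Ω,t)} [f_t + div(f u)] dx` within `S` at every
`t ∈ S` (`f_t = timeDerivWithin S f`).
[cite: MajdaBertozziCUP2002, §1.3 Prop. 1.3 eq. (1.16) (held text pp. 14–15)] -/
theorem hasDerivWithinAt_setIntegral_image_evolutionMap (hL : ODE.IsUniformlyLipschitzOn u S)
    (hu : IsSmoothSpaceTimeOn S u) (hS : Convex ℝ S) (h0 : (0 : ℝ) ∈ S) (hU : UniqueDiffOn ℝ S)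
    (hf : IsSmoothSpaceTimeOn S f) {Ω : Set E} (hΩm : MeasurableSet Ω)
    (hΩb : Bornology.IsBounded Ω) {t : ℝ} (ht : t ∈ S) :
    HasDerivWithinAt (fun s => ∫ x in ODE.evolutionMap u 0 s '' Ω, f s x)
      (∫ x in ODE.evolutionMap u 0 t '' Ω, (timeDerivWithin S f t x
        + VectorCalculus.divergence (fun y => f t y • u t y) x)) S t :=
  hasDerivWithinAt_setIntegral_image_flow hS h0 hU hu (isSmoothSpaceTimeOn_evolutionMap hL hu hS hU h0)
    (trajS hL hS h0) (ODE.evolutionMap_self u 0) hf hΩm hΩb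
    (fun _ hs => (bijective_evolutionMap_zero hL hS h0 hs).injective.injOn) ht

/-- **(1.16) along the trajectories of a divergence-free field**: if `div u(t,·) = 0`, then
`d/dt ∫_{X(Ω,t)} f dx = ∫_{X(Ω,t)} (f_t + u · ∇f) dx` within `S` at `t`.
[cite: MajdaBertozziCUP2002, §1.3 Prop. 1.3 eq. (1.16) with Prop. 1.4 (ii) (held text p. 14)] -/
theorem hasDerivWithinAt_setIntegral_image_evolutionMap_of_isDivFree
    (hL : ODE.IsUniformlyLipschitzOn u S) (hu : IsSmoothSpaceTimeOn S u) (hS : Convex ℝ S)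
    (h0 : (0 : ℝ) ∈ S) (hU : UniqueDiffOn ℝ S) (hf : IsSmoothSpaceTimeOn S f) {Ω : Set E}
    (hΩm : MeasurableSet Ω) (hΩb : Bornology.IsBounded Ω) {t : ℝ} (ht : t ∈ S)
    (hdiv : VectorCalculus.IsDivFree (u t)) :
    HasDerivWithinAt (fun s => ∫ x in ODE.evolutionMap u 0 s '' Ω, f s x)
      (∫ x in ODE.evolutionMap u 0 t '' Ω,
        (timeDerivWithin S f t x + fderiv ℝ (f t) x (u t x))) S t :=
  hasDerivWithinAt_setIntegral_image_flow_of_isDivFree hS h0 hU hu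
    (isSmoothSpaceTimeOn_evolutionMap hL hu hS hU h0) (trajS hL hS h0) (ODE.evolutionMap_self u 0)
    hf hΩm hΩb (fun _ hs => (bijective_evolutionMap_zero hL hS h0 hs).injective.injOn) ht hdiv

/-- **(1.16) with `f ≡ 1` along the trajectories: the rate of change of the volume of a domain
moving with the fluid** is `d/dt vol X(Ω,t) = ∫_{X(Ω,t)} div u dx` within `S` at every `t ∈ S`,
for every bounded measurable `Ω`.
[cite: MajdaBertozziCUP2002, §1.3 Prop. 1.3 eq. (1.16) with `f ≡ 1` (held text p. 14)] -/
theorem hasDerivWithinAt_volume_image_evolutionMap (hL : ODE.IsUniformlyLipschitzOn u S)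
    (hu : IsSmoothSpaceTimeOn S u) (hS : Convex ℝ S) (h0 : (0 : ℝ) ∈ S) (hU : UniqueDiffOn ℝ S)
    {Ω : Set E} (hΩm : MeasurableSet Ω) (hΩb : Bornology.IsBounded Ω) {t : ℝ} (ht : t ∈ S) :
    HasDerivWithinAt (fun s => (volume (ODE.evolutionMap u 0 s '' Ω)).toReal)
      (∫ x in ODE.evolutionMap u 0 t '' Ω, VectorCalculus.divergence (u t) x) S t :=
  hasDerivWithinAt_volume_image_flow hS h0 hU hu (isSmoothSpaceTimeOn_evolutionMap hL hu hS hU h0)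
    (trajS hL hS h0) (ODE.evolutionMap_self u 0) hΩm hΩb
    (fun _ hs => (bijective_evolutionMap_zero hL hS h0 hs).injective.injOn) ht

/-! ### Prop. 1.4 (i) ⟺ (ii) ⟺ (iii) -/

/-- **Prop. 1.4 (i) ⟺ (iii)** along the trajectories within `S`: the flow `X(·,t) = φ(t, 0, ·)`
is volume preserving on `S` (Def. 1.1, `IsIncompressibleFlowOn`) iff `J ≡ 1` on `S × E`.
[cite: MajdaBertozziCUP2002, §1.3 Def. 1.1, Prop. 1.4 (i) ⟺ (iii) (held text p. 14)] -/
theorem isIncompressibleFlowOn_evolutionMap_iff_det_fderiv_eq_one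
    (hL : ODE.IsUniformlyLipschitzOn u S) (hu : IsSmoothSpaceTimeOn S u) (hS : Convex ℝ S)
    (h0 : (0 : ℝ) ∈ S) (hU : UniqueDiffOn ℝ S) :
    IsIncompressibleFlowOn S (ODE.evolutionMap u 0) ↔
      ∀ t ∈ S, ∀ a, (fderiv ℝ (ODE.evolutionMap u 0 t) a).det = 1 :=
  isIncompressibleFlowOn_iff_det_fderiv_eq_one hS h0 hu (isSmoothSpaceTimeOn_evolutionMap hL hu hS hU h0)
    (trajS hL hS h0) (ODE.evolutionMap_self u 0)
    fun _ hs => (bijective_evolutionMap_zero hL hS h0 hs).injective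

/-- **Majda–Bertozzi Prop. 1.4 (i) ⟺ (ii) along the trajectories within `S`**: for `u` jointly
smooth on the convex time set `S ∋ 0` (of unique differentiability) with the Cauchy–Lipschitz
hypotheses, the particle-trajectory flow `X(·,t) = φ(t, 0, ·)` is incompressible on `S`
(`vol X(Ω,t) = vol Ω` for all measurable `Ω`, `t ∈ S`) iff `div u(t,·) = 0` for all `t ∈ S`.
[cite: MajdaBertozziCUP2002, §1.3 Def. 1.1, Prop. 1.4 (i) ⟺ (ii) (held text p. 14)] -/
theorem isIncompressibleFlowOn_evolutionMap_iff_isDivFree (hL : ODE.IsUniformlyLipschitzOn u S)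
    (hu : IsSmoothSpaceTimeOn S u) (hS : Convex ℝ S) (h0 : (0 : ℝ) ∈ S) (hU : UniqueDiffOn ℝ S) :
    IsIncompressibleFlowOn S (ODE.evolutionMap u 0) ↔ ∀ t ∈ S, VectorCalculus.IsDivFree (u t) :=
  isIncompressibleFlowOn_iff_isDivFree hS h0 hU hu (isSmoothSpaceTimeOn_evolutionMap hL hu hS hU h0)
    (trajS hL hS h0) (ODE.evolutionMap_self u 0) fun _ hs => bijective_evolutionMap_zero hL hS h0 hs

end Measure

end FinDim

/-! ### The same for classical Euler / Navier–Stokes solutions on `S` -/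

section Solutions

variable {E : Type*} [NormedAddCommGroup E] [InnerProductSpace ℝ E] [FiniteDimensional ℝ E]
  [CompleteSpace E] [MeasurableSpace E] [BorelSpace E]
variable {S : Set ℝ} {ν : ℝ} {f u : ℝ → E → E} {p : ℝ → E → ℝ}

/-- **The particle-trajectory flow of a classical (Euler or Navier–Stokes) solution is volume
preserving** on its convex time set `S ∋ 0` (of unique differentiability), provided the velocity
satisfies the Cauchy–Lipschitz hypotheses on `S` (e.g. bounded gradient on compact sub-slabs):
Prop. 1.4 (ii) ⇒ (i) with (ii) = the solution's incompressibility.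
[cite: MajdaBertozziCUP2002, §1.3 Def. 1.1, Prop. 1.4 (ii) ⇒ (i) (held text p. 14)] -/
theorem IsClassicalNSSolutionOn.isIncompressibleFlowOn_evolutionMap
    (h : IsClassicalNSSolutionOn S ν f u p) (hS : Convex ℝ S) (h0 : (0 : ℝ) ∈ S)
    (hU : UniqueDiffOn ℝ S) (hL : ODE.IsUniformlyLipschitzOn u S) :
    IsIncompressibleFlowOn S (ODE.evolutionMap u 0) :=
  (isIncompressibleFlowOn_evolutionMap_iff_isDivFree hL h.smooth_velocity hS h0 hU).2 h.divFree

omit [MeasurableSpace E] [BorelSpace E] in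
/-- For a classical solution, `J = det ∇_αX ≡ 1` along its particle trajectories within `S`.
[cite: MajdaBertozziCUP2002, §1.3 Prop. 1.4 (ii) ⇒ (iii) (held text p. 14); §2.5 "Incompressibility, div v = 0, implies det(∇_αX(α,t)) = 1" (p. 71)] -/
theorem IsClassicalNSSolutionOn.det_fderiv_evolutionMap_eq_one
    (h : IsClassicalNSSolutionOn S ν f u p) (hS : Convex ℝ S) (h0 : (0 : ℝ) ∈ S)
    (hU : UniqueDiffOn ℝ S) (hL : ODE.IsUniformlyLipschitzOn u S) {t : ℝ} (ht : t ∈ S) (a : E) :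
    (fderiv ℝ (ODE.evolutionMap u 0 t) a).det = 1 :=
  _root_.Literature.Analysis.FluidPDE.det_fderiv_evolutionMap_eq_one hL h.smooth_velocity hS h0
    hU h.divFree ht a

end Solutions

end Literature.Analysis.FluidPDE

end
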